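import Mathlib
import Summits.QuantumAdvantage.AdviceFreeQNC0.RingHardOdd
import Summits.QuantumAdvantage.AdviceFreeQNC0.DWalkOneBell
import Summits.QuantumAdvantage.AdviceFreeQNC0.OddPrimeTransport
import Summits.QuantumAdvantage.AdviceFreeQNC0.AffBells22FrameJunta
import Summits.QuantumAdvantage.AdviceFreeQNC0.AffBells34CoverHard
import Literature.Computability.MetaComplexity.SmolenskyProperty

/-!
# FanInRoot (1/11): the FAN-IN DIAL for exact play on the ring, the tree floor, even-stretch hub sets, the bare-cycle degree game

Lineage decomp-qadv-lens-1 g6, NODE «SupportDial» (refines ExactnessDial:27380 `NoPerfectConst3` along the fan-in axis).  This module: the dial `f ∈ NoPerfectFanIn3` /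
`f ∈ NoPerfectFanInAll` (no PERFECT strategy on the odd class of `C_n` when every output reads `≤ f n` inputs), monotonicity, the tree floor at polylog fan-in
(`noPerfectFanInPolylog3`, from `AffBells34.coverPolylogHard`), even-stretch hub configurations and `HubLoses`, the bare-cycle game `r ∈ SmallRingLosesDeg k` and its
large-`k` range from `ringHardOdd_two`.  Sorry-free; parametrised predicates only (no statement items).
-/

set_option linter.dupNamespace false -- D-0017: single-problem summit ⇒ `QuantumAdvantage.QuantumAdvantage` by design

namespace Summit.QuantumAdvantage.QuantumAdvantage.Theorems.FanInRoot

open Finset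
open Summit.QuantumAdvantage.AdviceFreeQNC0
open Literature.Computability.QuantumComplexity
open Literature.Computability.QuantumComplexity.RingHLF
open Literature.Computability.MetaComplexity
open scoped Classical

/-! ## §1 The fan-in dial (degree-`d` form and degree-free form) -/

/-- **THE DIAL.**  `f ∈ NoPerfectFanIn3`: for every constant `d`, for all large `n`, no ring strategy whose outputs are `𝔽₃`-degree-`≤ d` events AND
each read a set of at most `f n` inputs (`AffBells22.ReadsOnly`, ARBITRARY wiring) is perfect on the odd class.  `f = ⊤` is `T`; the dial is monotone
(`noPerfectFanIn3_mono`). [definition of the grading] -/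
def NoPerfectFanIn3 : Set (ℕ → ℕ) := {f |
  ∀ d : ℕ, ∃ n₀ : ℕ, ∀ n ≥ n₀, ∀ P : Fin n → Smolensky.CubeFn (ZMod 3) n, (∀ i, P i ∈ Smolensky.lowDeg (ZMod 3) n d) →
    (∀ i, ∃ S : Finset (Fin n), S.card ≤ f n ∧ AffBells22.ReadsOnly S (fun x => decide (P i x = 1))) →
      ∃ x : Fin n → Bool, OddZeros x ∧ ¬ Rel x (fun i => decide (P i x = 1)) }

/-- The DEGREE-FREE dial (what the hub engine actually proves): no strategy AT ALL with fan-in `≤ f n` is perfect on the odd class. -/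
def NoPerfectFanInAll : Set (ℕ → ℕ) := {f |
  ∃ n₀ : ℕ, ∀ n ≥ n₀, ∀ z : (Fin n → Bool) → Fin n → Bool,
    (∀ j, ∃ S : Finset (Fin n), S.card ≤ f n ∧ AffBells22.ReadsOnly S (fun x => z x j)) →
      ∃ x : Fin n → Bool, OddZeros x ∧ ¬ Rel x (z x) }

/-! ## §2 Monotonicity, degree-free ⟹ degree-`d`, and the TREE FLOOR R0 -/

variable {f g : ℕ → ℕ}

/-- Monotonicity of the dial. -/
theorem noPerfectFanIn3_mono (hfg : ∀ n, f n ≤ g n) (h : g ∈ NoPerfectFanIn3) : f ∈ NoPerfectFanIn3 := by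
  intro d
  obtain ⟨n₀, hn₀⟩ := h d
  refine ⟨n₀, fun n hn P hP hS => hn₀ n hn P hP fun i => ?_⟩
  obtain ⟨S, hSc, hSr⟩ := hS i
  exact ⟨S, hSc.trans (hfg n), hSr⟩

/-- FanInRoot helper `noPerfectFanInAll_mono` (lens-1 g6 FanInRoot package; see the module docstring). -/
theorem noPerfectFanInAll_mono (hfg : ∀ n, f n ≤ g n) (h : g ∈ NoPerfectFanInAll) : f ∈ NoPerfectFanInAll := by
  obtain ⟨n₀, hn₀⟩ := h
  refine ⟨n₀, fun n hn z hS => hn₀ n hn z fun j => ?_⟩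
  obtain ⟨S, hSc, hSr⟩ := hS j
  exact ⟨S, hSc.trans (hfg n), hSr⟩

/-- Degree-free ⟹ degree-`d` (the engine's statements feed the dial). -/
theorem noPerfectFanIn3_of_all (h : f ∈ NoPerfectFanInAll) : f ∈ NoPerfectFanIn3 := by
  intro d
  obtain ⟨n₀, hn₀⟩ := h
  exact ⟨n₀, fun n hn P _ hS => hn₀ n hn (fun x i => decide (P i x = 1)) hS⟩

/-- The odd class of `{0,1}ⁿ` has at least `2^(n−1)` patterns (`n ≥ 1`). [bookkeeping, gen 2] -/
theorem card_oddZeros_ge {n : ℕ} (hn : 1 ≤ n) :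
    2 ^ (n - 1) ≤ (univ.filter fun x : Fin n → Bool => OddZeros x).card := by
  classical
  obtain ⟨m, rfl⟩ : ∃ m, n = m + 1 := ⟨n - 1, by omega⟩
  rw [Nat.add_sub_cancel]
  have h := two_pow_le_card_odd_class (n := m)
  convert h using 2
  exact Finset.filter_congr (fun x _ => Iff.rfl)

/-- **R0, degree-free form (THEOREM).**  For every `C`, for all large `n`, no strategy with all fan-ins `≤ (log₂ n)^C` is perfect on the odd class —
corollary of the tree's `coverPolylogHard` (which even bounds the win MASS by `θ·2^{n−1}`). -/
theorem noPerfectFanInAll_polylog (C : ℕ) : (fun n => Nat.log 2 n ^ C) ∈ NoPerfectFanInAll := by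
  classical
  obtain ⟨θ, hθ, hall⟩ := AffBells34.coverPolylogHard
  obtain ⟨n₀, hn₀⟩ := hall C
  refine ⟨max n₀ 1, fun n hn z hz => ?_⟩
  choose S hS using hz
  by_contra hno
  simp only [not_exists, not_and, not_not] at hno
  have hw := hn₀ n (le_of_max_le_left hn) ∅ S (fun j x => z x j) (by simp)
    (fun k => by simpa using (hS k).1) (fun k => (hS k).2)
  have hcount : 2 ^ (n - 1) ≤ AffBells22.winCount (fun x k => z x k) := by
    unfold AffBells22.winCount
    calc 2 ^ (n - 1) ≤ (univ.filter fun x : Fin n → Bool => OddZeros x).card := card_oddZeros_ge (le_of_max_le_right hn)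
      _ ≤ _ := by
        refine card_le_card fun x hx => ?_
        simp only [mem_filter, mem_univ, true_and] at hx ⊢
        exact ⟨hx, hno x hx⟩
  have h1 : ((2 : ℝ) ^ (n - 1)) ≤ (AffBells22.winCount (fun x k => z x k) : ℝ) := by exact_mod_cast hcount
  have h2 : (0 : ℝ) < (2 : ℝ) ^ (n - 1) := by positivity
  have h3 : (AffBells22.winCount (fun x k => z x k) : ℝ) ≤ θ * (2 : ℝ) ^ (n - 1) := hw
  nlinarith

/-- **RUNG R0 (THEOREM).** -/
theorem noPerfectFanInPolylog3 (C : ℕ) : (fun n => Nat.log 2 n ^ C) ∈ NoPerfectFanIn3 := noPerfectFanIn3_of_all (noPerfectFanInAll_polylog C)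

/-! ## §3 Even-stretch hub configurations and the loses-predicate -/

/-- `H ⊆ ℤ/n` is an EVEN-STRETCH hub configuration: every cyclic gap between consecutive hubs contains an EVEN number of non-hubs
(equivalently: `n − |H|` is even and `h − rank_H(h)` has constant parity on `H`). [definition; decidable] -/
def EvenStretch (n : ℕ) : Set (Finset (Fin n)) := {H |
  (n - H.card) % 2 = 0 ∧ ∀ h ∈ H, ∀ h' ∈ H, (h.val + (H.filter fun i => i < h').card) % 2 = (h'.val + (H.filter fun i => i < h).card) % 2 }

/-- Inputs supported on the hubs (background `0`). -/
def HubSupported {n : ℕ} (H : Finset (Fin n)) : Set (Fin n → Bool) := {x |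
  ∀ i, i ∉ H → x i = false }

/-- **`H ∈ HubLoses n r`**: every strategy whose `j`-th output, ON HUB-SUPPORTED INPUTS, depends on at most `r` hub bits loses a hub-supported odd-class
input. [definition; the certificates' conclusion] -/
def HubLoses (n r : ℕ) : Set (Finset (Fin n)) := {H |
  ∀ z : (Fin n → Bool) → Fin n → Bool,
    (∀ j, ∃ R : Finset (Fin n), R ⊆ H ∧ R.card ≤ r ∧
        ∀ x x', x ∈ HubSupported H → x' ∈ HubSupported H → (∀ i ∈ R, x i = x' i) → z x j = z x' j) →
      ∃ x : Fin n → Bool, x ∈ HubSupported H ∧ OddZeros x ∧ ¬ Rel x (z x) }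

/-- From a fan-in set `S` (`ReadsOnly`) to the engine's hypothesis: on hub-supported inputs output `j` depends only on `S ∩ H`. -/
theorem dep_on_hubs {n : ℕ} {H S : Finset (Fin n)} {g : (Fin n → Bool) → Bool} (hS : AffBells22.ReadsOnly S g)
    (x x' : Fin n → Bool) (hx : x ∈ HubSupported H) (hx' : x' ∈ HubSupported H) (hR : ∀ i ∈ S ∩ H, x i = x' i) : g x = g x' := by
  refine hS x x' fun i hi => ?_
  by_cases hiH : i ∈ H
  · exact hR i (Finset.mem_inter.2 ⟨hi, hiH⟩)
  · rw [hx i hiH, hx' i hiH]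

/-! ## §4 The engine at `p = 2`: bare small cycles -/

/-- **`r ∈ SmallRingLosesDeg k`**: on the BARE `k`-cycle, every strategy all of whose output coordinates are `𝔽₂`-polynomials of degree `≤ r` in the input
loses some odd-class input. [NEW notion; the `p = 2` degree form of the hub game] -/
def SmallRingLosesDeg (k : ℕ) : Set ℕ := {r |
  ∀ w : (Fin k → Bool) → Fin k → Bool,
    (∀ j : Fin k, (fun β : Fin k → Bool => if w β j = true then (1 : ZMod 2) else 0) ∈ Smolensky.lowDeg (ZMod 2) k r) →
      ∃ β : Fin k → Bool, OddZeros β ∧ ¬ Rel β (w β) }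

/-- FanInRoot helper `smallRingLosesDeg_mono` (lens-1 g6 FanInRoot package; see the module docstring). -/
theorem smallRingLosesDeg_mono {k r r' : ℕ} (h : r' ≤ r) (hk : r ∈ SmallRingLosesDeg k) : r' ∈ SmallRingLosesDeg k :=
  fun w hw => hk w fun j => Smolensky.lowDeg_mono h (hw j)

/-! ### §6a The log-degree range is a TREE THEOREM (`ringHardOdd_two`, a MASS bound) -/

/-- **THEOREM (tree transfer).**  For every `r` there is `K` with `r ∈ SmallRingLosesDeg k` for all `k ≥ K` — from `ringHardOdd_two : RingHardOdd 2`
(degree `≤ log₂ k` maps win at most `θ·2^{k−1} < 2^{k−1}` odd inputs). -/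
theorem smallRingLosesDeg_of_large (r : ℕ) : ∃ K : ℕ, ∀ k ≥ K, r ∈ SmallRingLosesDeg k := by
  classical
  obtain ⟨θ, hθ, hall⟩ := ringHardOdd_two
  obtain ⟨n₀, hn₀⟩ := hall 1
  refine ⟨max (max n₀ 1) (2 ^ r), fun k hk w hw => ?_⟩
  have hkn₀ : n₀ ≤ k := le_trans (le_max_left _ _) (le_trans (le_max_left _ _) hk)
  have hk1 : 1 ≤ k := le_trans (le_max_right _ _) (le_trans (le_max_left _ _) hk)
  have hlog : r ≤ Nat.log 2 k := Nat.le_log_of_pow_le (by norm_num) (le_trans (le_max_right _ _) hk)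
  set P : Fin k → Smolensky.CubeFn (ZMod 2) k := fun j β => if w β j = true then 1 else 0 with hP
  have hdeg : ∀ j, P j ∈ Smolensky.lowDeg (ZMod 2) k ((Nat.log 2 k) ^ 1) := fun j => by
    rw [pow_one]; exact Smolensky.lowDeg_mono hlog (hw j)
  have hmass := hn₀ k hkn₀ P hdeg
  have hfun : ∀ β : Fin k → Bool, (fun j => decide (P j β = 1)) = w β := by
    intro β; funext j; simp only [hP]; by_cases h : w β j = true <;> simp [h]
  by_contra hno
  simp only [not_exists, not_and, not_not] at hno
  have hcount : 2 ^ (k - 1) ≤ (univ.filter fun x : Fin k → Bool => OddZeros x ∧ Rel x (fun j => decide (P j x = 1))).card := by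
    calc 2 ^ (k - 1) ≤ (univ.filter fun x : Fin k → Bool => OddZeros x).card := card_oddZeros_ge hk1
      _ ≤ _ := card_le_card fun x hx => by
          simp only [mem_filter, mem_univ, true_and] at hx ⊢
          exact ⟨hx, by rw [hfun x]; exact hno x hx⟩
  have h1 : ((2 : ℝ) ^ (k - 1)) ≤ ((univ.filter fun x : Fin k → Bool => OddZeros x ∧ Rel x (fun j => decide (P j x = 1))).card : ℝ) := by
    exact_mod_cast hcount
  have h2 : (0 : ℝ) < (2 : ℝ) ^ (k - 1) := by positivity
  nlinarith

end Summit.QuantumAdvantage.QuantumAdvantage.Theorems.FanInRoot
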